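/-
Copyright (c) 2026 The decomp-a2c cell. All rights reserved.
Released under Apache 2.0 license as described in the file LICENSE.
-/
import Summits.AtomisticToContinuum.Crystallization.Theorems.ChartedZeroExcessLayeredLatticeLiouvilleWF

/-!
# ChartedZeroExcessLayeredLatticeLiouville — part WG «FluxTerms»: the chain flux in mean square, telescoping along a window, and the planar part of the
  column flux pointwise (decomp-a2c-lens-2, g58; helper of stmt-AtomisticToContinuum-26636, leaf (LD′) `ModalLipschitzZ`; brick (4a) `ModalLipschitzAt`,
  vertical half (4a⊥), step (SG) of memo NODE-g58c — terms (B) and (C) and the window telescoping)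

Step (SG) bounds the vertical increment `Δ_γ(k₀) = ψ γ (k₀+1) − ψ γ k₀` of a harmonic field, column by column, by WB `increment_le_local`, whose flux datum is
`H_γ = max_{m ∈ W} ‖colFlux_γ(m) − colPlanar_γ(m)‖ = max_W ‖chainFlux (ψ γ)(m)‖` over a window `W` of layers.  By telescoping along the window,
`‖h(m)‖ ≤ avg_W ‖h‖ + 2·max_W ‖colPlanar‖ + Σ_W ‖DIV‖` (`h = colFlux − colPlanar`, `DIV(m) = colFlux(m) − colFlux(m−1)`); the three terms are
(B) the window average of the chain flux — this part: `Σ_{m ∈ P} ‖chainFlux T cf m‖² ≤ 9·(196F)²·Σ_{k ∈ J} ‖cf (k+1) − cf k‖²` (VP block form, VR block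
decay, VY band-weight Cauchy–Schwarz; no harmonicity);
(C) the planar part POINTWISE — this part: `‖colPlanar T ψ γ m‖ ≤ 108·F·G` for any bound `G` of the in-plane unit differences of `ψ` on the coordinate box of
half-width `⌊ϱ/c⌋` about `γ` in the layers `(m, m + ⌊ϱ/c⌋]` (WD lattice paths and the moment `Σ idxWt·N² ≤ 54`; no harmonicity);
(A) the divergence — WE/WF.
-/

namespace Summit.AtomisticToContinuum.Crystallization.Theorems.ChartedZeroExcessLayeredLatticeLiouville

open Summit.AtomisticToContinuum.Crystallization.Theorems.ChartedPlanarOrderRigidityDoor (E3)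
open Finset
open scoped InnerProductSpace RealInnerProductSpace BigOperators

noncomputable section FluxTerms

variable {c : ℝ} {a b : E3} {w : ℤ → E3}

/-! ### WG.1  (B) The chain flux of a column profile in mean square -/

/-- the block form of the chain flux, in norm: `‖chainFlux T cf m‖ ≤ 196F·Σ_{k ∈ [m−r, m+r]} bandWt m k·‖cf (k+1) − cf k‖` (VP `chainFlux_eq_sum_fluxBlock`, VR
`norm_fluxBlock_le_decay`). [formal bookkeeping] -/
theorem norm_fluxBlock_apply_le (hc : 0 < c) (hL : IsLayeredCrystal c a b w) {ϱ : ℝ} (cf : ℤ → E3) {T : Finset ℤ} {m : ℤ}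
    (hT : Icc (m - ⌊ϱ / c⌋₊) (m + 1 + ⌊ϱ / c⌋₊) ⊆ T) :
    ‖chainFlux ϱ a b w T cf m‖ ≤ 196 * kernelConst c * ∑ k ∈ Icc (m - ⌊ϱ / c⌋₊) (m + ⌊ϱ / c⌋₊), bandWt m k * ‖cf (k + 1) - cf k‖ := by
  rw [chainFlux_eq_sum_fluxBlock hc hL cf hT, mul_sum]
  refine (norm_sum_le _ _).trans (sum_le_sum fun k _ => ?_)
  calc ‖fluxBlock hc hL ϱ m k (cf (k + 1) - cf k)‖ ≤ ‖fluxBlock hc hL ϱ m k‖ * ‖cf (k + 1) - cf k‖ := ContinuousLinearMap.le_opNorm _ _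
    _ ≤ 196 * kernelConst c * bandWt m k * ‖cf (k + 1) - cf k‖ := mul_le_mul_of_nonneg_right (norm_fluxBlock_le_decay hc hL ϱ m k) (norm_nonneg _)
    _ = _ := by ring

/-- ★ (B) THE CHAIN FLUX IN MEAN SQUARE over a window `P` of layers: `Σ_{m ∈ P} ‖chainFlux T cf m‖² ≤ 9·(196F)²·Σ_{k ∈ J} ‖cf (k+1) − cf k‖²` for any `J`
containing the `⌊ϱ/c⌋`-bands of the layers of `P` (band-weight Cauchy–Schwarz VY `sq_sum_bandWt_mul_le` and the column sums VY `sum_sum_bandWt_mul_le`;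
uniform in `ϱ`). [this file, g58] -/
theorem sum_chainFlux_sq_le (hc : 0 < c) (hL : IsLayeredCrystal c a b w) {ϱ : ℝ} (cf : ℤ → E3) {T P J : Finset ℤ}
    (hT : ∀ m ∈ P, Icc (m - ⌊ϱ / c⌋₊) (m + 1 + ⌊ϱ / c⌋₊) ⊆ T) (hJ : ∀ m ∈ P, Icc (m - ⌊ϱ / c⌋₊) (m + ⌊ϱ / c⌋₊) ⊆ J) :
    ∑ m ∈ P, ‖chainFlux ϱ a b w T cf m‖ ^ 2 ≤ 9 * (196 * kernelConst c) ^ 2 * ∑ k ∈ J, ‖cf (k + 1) - cf k‖ ^ 2 := by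
  have hF := kernelConst_nonneg hc
  have hpt : ∀ m ∈ P, ‖chainFlux ϱ a b w T cf m‖ ^ 2 ≤ 3 * (196 * kernelConst c) ^ 2 * ∑ k ∈ J, bandWt m k * ‖cf (k + 1) - cf k‖ ^ 2 := by
    intro m hm
    have h1 := pow_le_pow_left₀ (norm_nonneg _) (norm_fluxBlock_apply_le hc hL cf (hT m hm)) 2
    have h2 := sq_sum_bandWt_mul_le (Icc (m - ⌊ϱ / c⌋₊) (m + ⌊ϱ / c⌋₊)) m fun k => ‖cf (k + 1) - cf k‖
    have h3 : ∑ k ∈ Icc (m - (⌊ϱ / c⌋₊ : ℤ)) (m + ⌊ϱ / c⌋₊), bandWt m k * ‖cf (k + 1) - cf k‖ ^ 2 ≤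
        ∑ k ∈ J, bandWt m k * ‖cf (k + 1) - cf k‖ ^ 2 :=
      sum_le_sum_of_subset_of_nonneg (hJ m hm) fun k _ _ => mul_nonneg (bandWt_nonneg m k) (sq_nonneg _)
    rw [mul_pow] at h1
    nlinarith [sq_nonneg (196 * kernelConst c)]
  refine (sum_le_sum hpt).trans ?_
  rw [← mul_sum]
  have h := sum_sum_bandWt_mul_le P J (x := fun k => ‖cf (k + 1) - cf k‖ ^ 2) fun k => sq_nonneg _
  nlinarith [sq_nonneg (196 * kernelConst c)]

/-! ### WG.2  Telescoping along a window -/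

/-- TELESCOPING ALONG A WINDOW: for `m, m⋆` in an integer interval `W`, `‖F m − F m⋆‖ ≤ Σ_{m' ∈ W} ‖F m' − F (m' − 1)‖`. [formal bookkeeping] -/
theorem norm_sub_le_sum_Icc (F : ℤ → E3) {lo hi m m' : ℤ} (hm : m ∈ Icc lo hi) (hm' : m' ∈ Icc lo hi) :
    ‖F m - F m'‖ ≤ ∑ k ∈ Icc lo hi, ‖F k - F (k - 1)‖ := by
  rw [mem_Icc] at hm hm'
  wlog hle : m' ≤ m generalizing m m'
  · rw [norm_sub_rev]
    exact this hm' hm (not_le.mp hle).le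
  have key := norm_sub_le_sum_line (fun k => F (m' + k)) (m - m')
  have h0 : min (m - m') 0 = 0 := min_eq_right (by omega)
  simp only [add_zero, h0, zero_add] at key
  rw [show m' + (m - m') = m by omega] at key
  refine key.trans (sum_le_sum_of_injOn' (fun i : ℕ => m' + ((i + 1 : ℕ) : ℤ)) (fun i _ j _ h => by simpa using h) (fun i hi => ?_)
    (fun k _ => norm_nonneg _) fun i _ => le_of_eq ?_)
  · rw [mem_range] at hi
    rw [mem_Icc]
    constructor <;> omega
  · push_cast
    rw [add_sub_assoc, add_sub_cancel_right]

/-- THE WINDOW AVERAGE: for `m` in an integer interval `W`, `#W·‖F m‖ ≤ Σ_{m⋆ ∈ W} ‖F m⋆‖ + #W·Σ_{m' ∈ W} ‖F m' − F (m' − 1)‖`. [formal bookkeeping] -/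
theorem card_mul_norm_le_sum (F : ℤ → E3) {lo hi m : ℤ} (hm : m ∈ Icc lo hi) :
    (#(Icc lo hi) : ℝ) * ‖F m‖ ≤ (∑ k ∈ Icc lo hi, ‖F k‖) + #(Icc lo hi) * ∑ k ∈ Icc lo hi, ‖F k - F (k - 1)‖ := by
  have h : ∀ m' ∈ Icc lo hi, ‖F m‖ ≤ ‖F m'‖ + ∑ k ∈ Icc lo hi, ‖F k - F (k - 1)‖ := fun m' hm' =>
    (norm_le_insert' (F m) (F m')).trans (by linarith [norm_sub_le_sum_Icc F hm hm'])
  have := sum_le_sum h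
  rw [sum_const, nsmul_eq_mul, sum_add_distrib, sum_const, nsmul_eq_mul] at this
  exact this

/-! ### WG.3  (C) The planar part of the column flux, pointwise -/

/-- the planar flux in norm: `‖planarFlux X β‖ ≤ F·Σ_{Y near X, Y.2 = β} idxWt (Y−X)·‖ψ Y.1 β − ψ X.1 β‖`. [formal bookkeeping] -/
theorem norm_planarFlux_le (hc : 0 < c) (hL : IsLayeredCrystal c a b w) (ϱ : ℝ) (ψ : Cell 2 → ℤ → E3) (X : Cell 2 × ℤ) (β : ℤ) :
    ‖planarFlux ϱ a b w ψ X β‖ ≤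
      kernelConst c * ∑ Y ∈ (finite_near_lsite hc hL X ϱ).toFinset with Y.2 = β, idxWt (Y - X) * ‖ψ Y.1 Y.2 - ψ X.1 Y.2‖ := by
  rw [planarFlux_eq_sum (mem_nearFinset_of_le hc hL ϱ X) ψ β, mul_sum]
  exact (norm_sum_le _ _).trans (sum_le_sum fun Y _ => (norm_nearK_le_idxWt hc hL ϱ X Y _).trans (le_of_eq (by ring)))

/-- counting the cut layers: for an offset with vertical part `t`, at most `t⁺ ≤ N(v)` layers `α ≤ m` have `m − α < t`. [formal bookkeeping] -/
theorem count_cut_layers_le (T : Finset ℤ) (m : ℤ) (v : Cell 2 × ℤ) :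
    (#({α ∈ T.filter (· ≤ m) | m - α < v.2}) : ℝ) ≤ idxNorm v := by
  have hsub : {α ∈ T.filter (· ≤ m) | m - α < v.2} ⊆ Ioc (m - v.2) m := fun α hα => by
    simp only [mem_filter, mem_Ioc] at hα ⊢
    omega
  have h1 := card_le_card hsub
  rw [Int.card_Ioc] at h1
  have h2 : (m - (m - v.2)).toNat ≤ v.2.natAbs := by omega
  exact_mod_cast h1.trans (h2.trans (natAbs_snd_le_idxNorm v))

/-- ★★ (C) THE PLANAR PART OF THE COLUMN FLUX, POINTWISE: if the in-plane unit differences of `ψ` are bounded by `G` on the coordinate box of half-width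
`⌊ϱ/c⌋` about `γ` in the layers `(m, m + ⌊ϱ/c⌋]`, then `‖colPlanar T ψ γ m‖ ≤ 108·F·G` — each planar bond `ψ δ β − ψ γ β` is a lattice path of
`≤ 2N` in-plane unit steps (WD `norm_sub_le_of_box`), and the cut `α ≤ m < β` is crossed by at most `N` translates of each offset, so the total weight is the
moment `Σ idxWt·N² ≤ 54`; uniform in `ϱ` and `T`, no harmonicity. [this file, g58] -/
theorem norm_colPlanar_le (hc : 0 < c) (hL : IsLayeredCrystal c a b w) {ϱ : ℝ} (ψ : Cell 2 → ℤ → E3) (T : Finset ℤ) (γ : Cell 2) (m : ℤ) {G : ℝ}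
    (hG0 : 0 ≤ G)
    (hG : ∀ (p : Cell 2) (β : ℤ), (∀ j, |p j - γ j| ≤ (⌊ϱ / c⌋₊ : ℤ)) → m < β → β ≤ m + ⌊ϱ / c⌋₊ →
      ‖latDiff idxAxis₁ ψ p β‖ ≤ G ∧ ‖latDiff idxAxis₂ ψ p β‖ ≤ G) :
    ‖colPlanar ϱ a b w T ψ γ m‖ ≤ 108 * kernelConst c * G := by
  have hF := kernelConst_nonneg hc
  -- the planar flux across the cut, bond by bond
  have hpf : ∀ α ∈ T.filter (· ≤ m), ∀ β ∈ T.filter (m < ·), ‖planarFlux ϱ a b w ψ (γ, α) β‖ ≤ 2 * kernelConst c * G *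
      ∑ Y ∈ (finite_near_lsite hc hL (γ, α) ϱ).toFinset with Y.2 = β, idxWt (Y - (γ, α)) * (idxNorm (Y - (γ, α)) : ℝ) := by
    intro α hα β hβ
    have hαm : α ≤ m := (mem_filter.mp hα).2
    have hmβ : m < β := (mem_filter.mp hβ).2
    have hsum : ∑ Y ∈ (finite_near_lsite hc hL (γ, α) ϱ).toFinset with Y.2 = β, idxWt (Y - (γ, α)) * ‖ψ Y.1 Y.2 - ψ (γ, α).1 Y.2‖ ≤
        ∑ Y ∈ (finite_near_lsite hc hL (γ, α) ϱ).toFinset with Y.2 = β, 2 * G * (idxWt (Y - (γ, α)) * (idxNorm (Y - (γ, α)) : ℝ)) := by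
      refine sum_le_sum fun Y hY => ?_
      obtain ⟨hYn, hYβ⟩ := mem_filter.mp hY
      have hnear := idxNorm_le_of_near hc hL ((finite_near_lsite hc hL (γ, α) ϱ).mem_toFinset.mp hYn)
      obtain ⟨⟨d, t⟩, rfl⟩ : ∃ v : Cell 2 × ℤ, Y = (γ + v.1, α + v.2) := ⟨Y - (γ, α), Prod.ext (by simp) (by simp)⟩
      dsimp only at hnear hYβ ⊢
      have hv : (γ + d, α + t) - (γ, α) = (d, t) := Prod.ext (add_sub_cancel_left _ _) (add_sub_cancel_left _ _)
      rw [hv] at hnear ⊢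
      have hM : ∀ j, |d j| ≤ ((idxNorm (d, t) : ℕ) : ℤ) := fun j => by
        have h := natAbs_fst_le_idxNorm (d, t) j
        dsimp only at h
        rw [Int.abs_eq_natAbs]
        exact_mod_cast h
      have ht : t ≤ ((idxNorm (d, t) : ℕ) : ℤ) := by
        have h := natAbs_snd_le_idxNorm (d, t)
        dsimp only at h
        omega
      have hNr : ((idxNorm (d, t) : ℕ) : ℤ) ≤ ⌊ϱ / c⌋₊ := by exact_mod_cast hnear
      have hbox := norm_sub_le_of_box (fun p => ψ p (α + t)) γ d hM (G := G) fun p hp => by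
        have h := hG p (α + t) (fun j => (hp j).trans hNr) (by omega) (by omega)
        rw [latDiff_axis₁_apply, latDiff_axis₂_apply] at h
        exact h
      have h2 : ((((d 0).natAbs + (d 1).natAbs : ℕ)) : ℝ) ≤ 2 * idxNorm (d, t) := by
        have e0 : (((d 0).natAbs : ℕ) : ℝ) ≤ idxNorm (d, t) := by exact_mod_cast natAbs_fst_le_idxNorm (d, t) 0
        have e1 : (((d 1).natAbs : ℕ) : ℝ) ≤ idxNorm (d, t) := by exact_mod_cast natAbs_fst_le_idxNorm (d, t) 1
        push_cast
        linarith
      have hw := idxWt_nonneg (d, t)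
      calc idxWt (d, t) * ‖ψ (γ + d) (α + t) - ψ γ (α + t)‖ ≤ idxWt (d, t) * (((((d 0).natAbs + (d 1).natAbs : ℕ)) : ℝ) * G) :=
            mul_le_mul_of_nonneg_left hbox hw
        _ ≤ idxWt (d, t) * (2 * (idxNorm (d, t) : ℝ) * G) := mul_le_mul_of_nonneg_left (mul_le_mul_of_nonneg_right h2 hG0) hw
        _ = 2 * G * (idxWt (d, t) * (idxNorm (d, t) : ℝ)) := by ring
    calc ‖planarFlux ϱ a b w ψ (γ, α) β‖
        ≤ kernelConst c * ∑ Y ∈ (finite_near_lsite hc hL (γ, α) ϱ).toFinset with Y.2 = β, idxWt (Y - (γ, α)) * ‖ψ Y.1 Y.2 - ψ (γ, α).1 Y.2‖ :=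
          norm_planarFlux_le hc hL ϱ ψ (γ, α) β
      _ ≤ kernelConst c * ∑ Y ∈ (finite_near_lsite hc hL (γ, α) ϱ).toFinset with Y.2 = β, 2 * G * (idxWt (Y - (γ, α)) * (idxNorm (Y - (γ, α)) : ℝ)) :=
          mul_le_mul_of_nonneg_left hsum hF
      _ = _ := by rw [← mul_sum]; ring
  -- collapsing the fibres and passing to offsets
  have hinner : ∀ α ∈ T.filter (· ≤ m),
      ∑ β ∈ T.filter (m < ·), ∑ Y ∈ (finite_near_lsite hc hL (γ, α) ϱ).toFinset with Y.2 = β, idxWt (Y - (γ, α)) * (idxNorm (Y - (γ, α)) : ℝ) ≤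
        ∑ v ∈ (idxBox ⌊ϱ / c⌋₊).filter (fun v => m - α < v.2), idxWt v * (idxNorm v : ℝ) := by
    intro α _
    rw [sum_fiberwise_eq_sum_filter]
    refine sum_le_sum_of_injOn' (· - (γ, α)) (fun _ _ _ _ h => sub_left_injective h) (fun Y hY => ?_)
      (fun v _ => mul_nonneg (idxWt_nonneg v) (Nat.cast_nonneg _)) fun _ _ => le_rfl
    obtain ⟨hYn, hYβ⟩ := mem_filter.mp hY
    refine mem_filter.mpr ⟨mem_idxBox (idxNorm_le_of_near hc hL ((finite_near_lsite hc hL (γ, α) ϱ).mem_toFinset.mp hYn)), ?_⟩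
    have hlt : m < Y.2 := (mem_filter.mp hYβ).2
    simp only [Prod.snd_sub]
    omega
  -- exchanging the sums and counting the cut layers per offset
  have hswap : ∑ α ∈ T.filter (· ≤ m), ∑ v ∈ (idxBox ⌊ϱ / c⌋₊).filter (fun v => m - α < v.2), idxWt v * (idxNorm v : ℝ) =
      ∑ v ∈ idxBox ⌊ϱ / c⌋₊, (#({α ∈ T.filter (· ≤ m) | m - α < v.2}) : ℝ) * (idxWt v * (idxNorm v : ℝ)) := by
    rw [sum_comm' (t' := idxBox ⌊ϱ / c⌋₊) (s' := fun v => {α ∈ T.filter (· ≤ m) | m - α < v.2})]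
    · exact sum_congr rfl fun v _ => by rw [sum_const, nsmul_eq_mul]
    · intro α v
      simp only [mem_filter]
      tauto
  have h54 : ∑ v ∈ idxBox ⌊ϱ / c⌋₊, idxWt v * (idxNorm v : ℝ) ^ 2 ≤ 54 := by
    simpa only [sub_zero] using sum_idxWt_mul_sq_le (idxBox ⌊ϱ / c⌋₊) 0
  have hcount : ∑ v ∈ idxBox ⌊ϱ / c⌋₊, (#({α ∈ T.filter (· ≤ m) | m - α < v.2}) : ℝ) * (idxWt v * (idxNorm v : ℝ)) ≤ 54 :=
    (sum_le_sum fun v _ => (mul_le_mul_of_nonneg_right (count_cut_layers_le T m v) (mul_nonneg (idxWt_nonneg v) (Nat.cast_nonneg _))).trans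
      (le_of_eq (by ring))).trans h54
  -- assembling
  calc ‖colPlanar ϱ a b w T ψ γ m‖ = ‖∑ α ∈ T.filter (· ≤ m), ∑ β ∈ T.filter (m < ·), planarFlux ϱ a b w ψ (γ, α) β‖ := rfl
    _ ≤ ∑ α ∈ T.filter (· ≤ m), ∑ β ∈ T.filter (m < ·), ‖planarFlux ϱ a b w ψ (γ, α) β‖ :=
        (norm_sum_le _ _).trans (sum_le_sum fun α _ => norm_sum_le _ _)
    _ ≤ ∑ α ∈ T.filter (· ≤ m), ∑ β ∈ T.filter (m < ·), 2 * kernelConst c * G *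
          ∑ Y ∈ (finite_near_lsite hc hL (γ, α) ϱ).toFinset with Y.2 = β, idxWt (Y - (γ, α)) * (idxNorm (Y - (γ, α)) : ℝ) :=
        sum_le_sum fun α hα => sum_le_sum fun β hβ => hpf α hα β hβ
    _ = 2 * kernelConst c * G * ∑ α ∈ T.filter (· ≤ m), ∑ β ∈ T.filter (m < ·),
          ∑ Y ∈ (finite_near_lsite hc hL (γ, α) ϱ).toFinset with Y.2 = β, idxWt (Y - (γ, α)) * (idxNorm (Y - (γ, α)) : ℝ) := by
        simp only [← mul_sum]
    _ ≤ 2 * kernelConst c * G * ∑ α ∈ T.filter (· ≤ m), ∑ v ∈ (idxBox ⌊ϱ / c⌋₊).filter (fun v => m - α < v.2), idxWt v * (idxNorm v : ℝ) :=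
        mul_le_mul_of_nonneg_left (sum_le_sum hinner) (by positivity)
    _ ≤ 2 * kernelConst c * G * 54 := by rw [hswap]; exact mul_le_mul_of_nonneg_left hcount (by positivity)
    _ = 108 * kernelConst c * G := by ring

/-! ### WG.4  The closed statement of this part -/

/-- The content of part WG as one closed proposition: (B) the chain flux in mean square and (C) the planar part of the column flux pointwise. -/
def FluxTermsShape : Prop :=
  ∀ c : ℝ, 0 < c → ∀ (a b : E3) (w : ℤ → E3), IsLayeredCrystal c a b w → ∀ (ϱ : ℝ),
    (∀ (cf : ℤ → E3) (T P J : Finset ℤ), (∀ m ∈ P, Icc (m - ⌊ϱ / c⌋₊) (m + 1 + ⌊ϱ / c⌋₊) ⊆ T) →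
      (∀ m ∈ P, Icc (m - ⌊ϱ / c⌋₊) (m + ⌊ϱ / c⌋₊) ⊆ J) →
        ∑ m ∈ P, ‖chainFlux ϱ a b w T cf m‖ ^ 2 ≤ 9 * (196 * kernelConst c) ^ 2 * ∑ k ∈ J, ‖cf (k + 1) - cf k‖ ^ 2) ∧
    ∀ (ψ : Cell 2 → ℤ → E3) (T : Finset ℤ) (γ : Cell 2) (m : ℤ) (G : ℝ), 0 ≤ G →
      (∀ (p : Cell 2) (β : ℤ), (∀ j, |p j - γ j| ≤ (⌊ϱ / c⌋₊ : ℤ)) → m < β → β ≤ m + ⌊ϱ / c⌋₊ →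
        ‖latDiff idxAxis₁ ψ p β‖ ≤ G ∧ ‖latDiff idxAxis₂ ψ p β‖ ≤ G) →
      ‖colPlanar ϱ a b w T ψ γ m‖ ≤ 108 * kernelConst c * G

/-- WG holds. [this file, g58] -/
theorem fluxTermsShape_holds : FluxTermsShape :=
  fun _c hc _a _b _w hL _ϱ => ⟨fun cf _T _P _J hT hJ => sum_chainFlux_sq_le hc hL cf hT hJ,
    fun ψ T γ m _G hG0 hG => norm_colPlanar_le hc hL ψ T γ m hG0 hG⟩

end FluxTerms

end Summit.AtomisticToContinuum.Crystallization.Theorems.ChartedZeroExcessLayeredLatticeLiouville
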